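import Literature.NumberTheory.LFunctions.Equivalents
import Literature.NumberTheory.LFunctions.DeBruijnHDiv
import HarnessLib

/-!
# Barrier: Newman's conjecture `Λ ≥ 0` (Rodgers–Tao 2020) — the Riemann hypothesis, if true, is only barely so

Barrier catalogue `Literature/Barriers/RiemannHypothesis/` (D-0021), entry `NewmanConjecture`
(namespace `Literature.Barriers.RiemannHypothesis`; the catalogued declaration is `NewmanConjecture`, the
negation of the de Bruijn route `DeBruijnRoute`, equivalent to the tree's fact `Literature.NumberTheory.LFunctions.rodgers_tao`).

## The technique (de Bruijn 1950; Rodgers–Tao 2020, §1)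

With `Φ(u) = ∑_{n ≥ 1} (2π²n⁴e^{9u} − 3πn²e^{5u}) exp(−πn²e^{4u})` and de Bruijn's family
`H_t(z) = ∫₀^∞ e^{tu²} Φ(u) cos(zu) du` (`Literature.NumberTheory.LFunctions.deBruijnH`; `H_0(z) = ξ(1/2 + iz/2)/8`): "De Bruijn showed
that the zeroes of `H_t` are purely real for `t ≥ 1/2`, and if `H_t` has purely real zeroes for some
`t`, then `H_{t'}` has purely real zeroes for all `t' > t`. Newman strengthened this result by showing that
there is an absolute constant `−∞ < Λ ≤ 1/2`, now known as the De Bruijn–Newman constant, with the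
property that `H_t` has purely real zeroes if and only if `t ≥ Λ`. The Riemann hypothesis is then clearly
equivalent to the upper bound `Λ ≤ 0`." So one route to RH is to prove that `H_t` has only real zeros for
some `t < 0` (`DeBruijnRoute`), which gives RH by monotonicity (`riemannHypothesis_of_deBruijnRoute`,
proved here from the tree's facts `Literature.NumberTheory.LFunctions.HasOnlyRealZeros.mono_deBruijnH` and
`Literature.NumberTheory.LFunctions.riemannHypothesis_iff_hasOnlyRealZeros_deBruijnH_zero`).

## The obstruction (what this file vendors)

"Newman conjectured the complementary lower bound `Λ ≥ 0`, and noted that this conjecture asserts that if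
the Riemann hypothesis is true, it is only 'barely so'." **Theorem 1.1** (Rodgers–Tao 2020): "One has
`Λ ≥ 0`." In the tree's `sInf`-free vocabulary this is exactly the named fact `Literature.NumberTheory.LFunctions.rodgers_tao`
(`∀ t < 0, ¬ HasOnlyRealZeros (H_t)`), i.e. `¬ DeBruijnRoute`; the barrier `NewmanConjecture` is stated as
that negation and proved equivalent to `Literature.NumberTheory.LFunctions.rodgers_tao` (`NewmanConjecture_iff_rodgers_tao`).
Dobner 2020 reproves Newman's conjecture without any information on the zeros of `ζ` and extends it:
every `F` in the extended Selberg class has a de Bruijn–Newman constant `Λ_F` (Thm. 1) and `Λ_F ≥ 0`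
(Thm. 2) — recorded informally (the tree has no `Λ_F`).

## Scope of the barrier (audit 2026-08-16): the Gaussian factor only; the sibling linear-factor route

The theorem (`NewmanConjecture_holds` in the proofs companion, sorry-free) is exactly `¬ DeBruijnRoute`:
the GAUSSIAN universal factor `e^{tu²}` (backward heat flow). The technique class "universal factors /
Pólya–de Bruijn kernel modifications / Laguerre–Pólya deformations" is larger: by Pólya's characterisation
(`φ` is a universal factor iff `φ(iz)` is in the Laguerre–Pólya class [NewmanWu2020, Thm. 2]) it consists of
the routes "`Φ/φ` has a real-rooted transform", and `Λ ≥ 0` closes precisely those with zero-free symbol.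
IN PRINT nothing else is closed. IN THE TREE (2026-08-16, not published) the whole REAL EVEN cone of de
Bruijn's universal factors `e^{λu²}∏(1 + u²/a_k²)` is closed as well: the summit-side refutation
`Summit.RiemannHypothesis.RiemannHypothesis.Theorems.UniversalFactorLaplaceLoophole_refuted` (route
`Theses/UniversalFactor.lean`, Cardon's Question 7) proves that for EVERY `a > 0` the Laplace(`a`)-smoothed
transform `F_a = ∫₀^∞ Φ(u)(1 + u²/a²)⁻¹cos(zu) du` has a non-real zero (wide `a < π/8`: residue at `u = ia`;
`π/8 ≤ a ≤ 32`: kernel-checked one-point Laguerre certificates, `native_decide`; `a ≥ 32`: a log-free energy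
gap for the Lorentz-filtered Hardy function + L²-pigeonhole + two-step Laguerre interlacing), and
`…Theses.UniversalFactor.MixedFactorReduction_holds` propagates the failure to every finite even factor
(this Literature file cannot import summit-side theorems; they are negative knowledge, `ledger negatives`).
What remains uncovered — in print AND in the tree — are Pólya's HERMITIAN, non-even universal factors,
all of which imply the ONE-PARAMETER sibling *linear-factor route* (real-rootedness of the one-sided
exponential smoothing `(1 − D/a)⁻¹H_0 = (1 + D/a)F_a`, last section of this file; weaker than the refuted
Laplace statement, which it does not inherit), expected false; the last section records the reduction,
what transfers from the even ray (close pairs of zeta zeros for bounded `a` [CsordasSmithVarga1994], the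
integration limit [LagariasMontague2011], picket-fence rigidity for strip-narrowing factors [Lagarias2005])
and what does not (the log-free energy gap), i.e. what a refutation would need. Proofs-companion audit
(same day, `NewmanConjectureProofs.lean`): the WIDE WINDOW `0 < |a| < π/8` of the linear ray is closed as
well wherever `Φ(ia) ≠ 0` — one governed (one-signed) tail of `G_a` already contradicts real-rootedness,
by a growth argument (last section) — so the residual family is `|a| ≥ π/8` together with the residue
zero `a = ±a₀`, `a₀ = 0.3194150268…`; and the kernel-division normalisation `linearFactorH` loses no
generality (a real solution `G_a + Ce^{az}`, `C ≠ 0`, of `G − G'/a = H_0` never has only real zeros, same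
argument).

## References

* [RodgersTaoFMP2020] B. Rodgers, T. Tao, *The de Bruijn–Newman constant is non-negative*, Forum Math.
  Pi 8 (2020), e6; arXiv:1801.05914 (read: abstract, §1 with Theorem 1.1 and Remark 1.2).
* [Dobner2020] A. Dobner, *A proof of Newman's conjecture for the extended Selberg class*,
  arXiv:2005.05142 (read: §1, Theorems 1–2).
* [Newman1976] C. M. Newman, *Fourier transforms with only real zeros*, Proc. AMS 61 (1976);
  [Bruijn1950] N. G. de Bruijn, *The roots of trigonometric integrals*, Duke Math. J. 17 (1950);
  [PlattTrudgianBLMS2021] D. Platt, T. Trudgian, Bull. LMS 53 (2021) (`Λ ≤ 0.2`) — as cited in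
  `Literature/NumberTheory/LFunctions/{DeBruijnNewman,Equivalents}.lean`.
* [NewmanWu2020] C. M. Newman, W. Wu, *Constants of de Bruijn–Newman type in analytic number theory and
  statistical physics*, Bull. AMS 57 (2020) = arXiv:1901.06596 (read: §2.2 Thm. 2 — Pólya's
  characterisation of universal factors; §2.3 strong universal factors, Thms. 7–8; §2.4).
* [BrandenChasse2014] P. Brändén, M. Chasse, *Classification theorems for operators preserving zeros in a
  strip*, arXiv:1402.2795 (read: §1, Thms. 1.6–1.8 and Remark 1.10 — de Bruijn's `cos(λD)` theorem, the
  strong-universal-factor property (I); §6).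
* [Lagarias2005] J. C. Lagarias, *Zero spacing distributions for differenced L-functions*, Acta Arith. 120
  (2005) = arXiv:math/0601653 (read: abstract, Thm. 2.1, Thm. 4.1 — zeros of `ξ(s+h) ± ξ(s−h)` are an
  asymptotic picket fence, under RH for all `h ≠ 0`).
* [LagariasMontague2011] J. C. Lagarias, D. Montague, *The integral of the Riemann ξ-function*, Comment.
  Math. Univ. St. Pauli 60 (2011) = arXiv:1106.4348 (read: §1.2, Thm. 2.1 — `Λ^{(−1)} = +∞`).
* [CsordasSmithVarga1994] G. Csordas, W. Smith, R. S. Varga, *Lehmer pairs of zeros, the de Bruijn–Newman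
  constant Λ, and the Riemann hypothesis*, Constr. Approx. 10 (1994) (as quoted in [RodgersTaoFMP2020, §1]).
* [Montgomery1973] H. L. Montgomery, *The pair correlation of zeros of the zeta function*, Proc. Symp. Pure
  Math. 24 (1973) (small normalised gaps under RH; as used in [RodgersTaoFMP2020, §1]).
* [Romik2019] D. Romik, *Orthogonal polynomial expansions for the Riemann xi function*, arXiv:1902.06330
  (read: §5 pp. 20–21 with Thm. 9 — Hermite Poisson flow = Pólya–de Bruijn flow at time `(r²−1)/4`; Thm. 15
  p. 29 — the `f_n`-Poisson flow is of exponential type; Prop. 18 pp. 31–32 — it does not preserve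
  hyperbolicity; open problems p. 63).
* [Edwards1974] H. M. Edwards, *Riemann's Zeta Function*, Academic Press 1974, §11.1 (pp. 225–226: the theta
  kernel and all its derivatives tend to `0` as `x → i^{1/2}`, i.e. `Φ^{(k)}(u) → 0` as `u → iπ/8`).
-/

noncomputable section

open Complex

namespace Literature.Barriers.RiemannHypothesis

/-! ## The technique: de Bruijn's route -/

/-- **de Bruijn's route to RH**: `H_t` has only real zeros for some `t < 0` (equivalently, with
Newman's theorem, `Λ < 0`). [cite: RodgersTaoFMP2020, §1] -/
def DeBruijnRoute : Prop :=
  ∃ t : ℝ, t < 0 ∧ Literature.NumberTheory.LFunctions.HasOnlyRealZeros (Literature.NumberTheory.LFunctions.deBruijnH t)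

/-- The route would prove RH: real zeros of `H_t` persist for `t' ≥ t` (de Bruijn's monotonicity,
the tree's fact `Literature.NumberTheory.LFunctions.HasOnlyRealZeros.mono_deBruijnH`), so `H_0` has only real zeros, which is RH
(`Literature.NumberTheory.LFunctions.riemannHypothesis_iff_hasOnlyRealZeros_deBruijnH_zero`). "The Riemann hypothesis is then clearly
equivalent to the upper bound `Λ ≤ 0`." [cite: RodgersTaoFMP2020, §1] -/
theorem riemannHypothesis_of_deBruijnRoute (hmono : Literature.NumberTheory.LFunctions.HasOnlyRealZeros.mono_deBruijnH)
    (hiff : Literature.NumberTheory.LFunctions.riemannHypothesis_iff_hasOnlyRealZeros_deBruijnH_zero) :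
    DeBruijnRoute → RiemannHypothesis := by
  rintro ⟨t, ht, hreal⟩
  exact hiff.2 (hmono ht.le hreal)

/-! ## The barrier -/

/-- **Barrier `NewmanConjecture` (Rodgers–Tao 2020, Theorem 1.1: `Λ ≥ 0`).** For every `t < 0` the
function `H_t` has a non-real zero; equivalently de Bruijn's route is closed: `¬ DeBruijnRoute`. "This
conjecture asserts that if the Riemann hypothesis is true, it is only 'barely so'": RH is the boundary
case `Λ = 0` (`RH ↔ Λ ≤ 0`, and `Λ ≥ 0`). Equivalent to the tree's named fact `Literature.NumberTheory.LFunctions.rodgers_tao`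
(`NewmanConjecture_iff_rodgers_tao`).

BARRIER (structured block, D-0021):
- technique_class: de-Bruijn-Newman backward-heat-flow Gaussian-universal-factor real-zeros-of-H_t; the entry is also the one to address for universal-factors / Polya-deBruijn-kernel / Laguerre-Polya-deformation ideas (kernel `Φ/φ` for a universal factor `φ`, operator form `ψ(D)⁻¹H_0` with `ψ` in the Laguerre–Pólya class), of which it CLOSES exactly the symbols with a Gaussian factor `e^{−αw²}`, `α > 0` (the zero-free symbols `ψ = c·e^{−αw²+βw}` and every Laguerre–Pólya `ψ` they divide) — see `scope_caveats` (barrier audit 2026-08-16)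
- blocks: RiemannHypothesis via `DeBruijnRoute` — real-rootedness of `H_t = ∫ e^{tu²}Φ(u)cos(zu)du` for some `t < 0`, i.e. `Λ < 0` — and hence via any argument whose conclusion would survive the backward heat flow for a positive time (RH "with room to spare") [cite: RodgersTaoFMP2020, §1 and Thm. 1.1]
- because: `Λ ≥ 0` [cite: RodgersTaoFMP2020, Thm. 1.1]: assuming `Λ < 0`, the zeros of `H_t`, `Λ < t ≤ 0`, relax to local equilibrium (near-arithmetic-progression spacing at `t = 0`), contradicting Montgomery's pair-correlation estimates for the zeros of `ζ` [cite: RodgersTaoFMP2020, abstract and §1]; a second proof needs no information on the zeros and gives `Λ_F ≥ 0` for every `F` in the extended Selberg class [cite: Dobner2020, Thm. 2]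
- evasions_known: none for the Gaussian factor: with `Λ ≥ 0`, RH is equivalent to the boundary case `Λ = 0` [cite: RodgersTaoFMP2020, §1]; progress is possible only from above (`Λ ≤ 0.2`, the tree's `Literature.NumberTheory.LFunctions.platt_trudgian`) [cite: PlattTrudgianBLMS2021, Cor. 2]. NOT evasions but siblings outside the theorem: universal factors with a zero, i.e. Laguerre–Pólya symbols `ψ` with a real zero (Pólya's characterisation of universal factors [cite: NewmanWu2020, Thm. 2]; the only catalogued strip-narrowing operators are `e^{−λD²}` and de Bruijn's `cos(λD)`-type [cite: BrandenChasse2014, §1]). Of these, the REAL EVEN ones (zeros in pairs `±b`: de Bruijn's cone `e^{λu²}∏(1 + u²/a_k²)`) are closed IN THE TREE, not in print: `Summit.RiemannHypothesis.RiemannHypothesis.Theorems.UniversalFactorLaplaceLoophole_refuted` (2026-08-16; every `a > 0`) with `…Theses.UniversalFactor.MixedFactorReduction_holds`; the HERMITIAN NON-EVEN ones (a zero `b` without `−b`) all imply the linear-factor route of the last section (`∃ a ≠ 0, HasOnlyRealZeros (linearFactorH a)`: real-rootedness of `(1 − D/a)⁻¹H_0 = (1 + D/a)F_a`, the one-sided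 exponential smoothing of `H_0`), which neither `Λ ≥ 0` nor the summit-side refutation addresses and which is neither proved nor refuted anywhere as a whole (its wide window `0 < |a| < π/8`, `Φ(ia) ≠ 0`, is closed by a one-signed tail plus growth, last section; open: `|a| ≥ π/8` and `a = ±a₀`)
- status: established
- scope_caveats: closes exactly the `t < 0` (strict) Gaussian route; proving real-rootedness of `H_0` itself (`t = 0`, which IS RH by `Literature.NumberTheory.LFunctions.riemannHypothesis_iff_hasOnlyRealZeros_deBruijnH_zero`) is untouched. DICHOTOMY for the full Laguerre–Pólya deformation class (audit 2026-08-16, informal): a route "`H_0 = ψ(D)G` with `G` real entire of order `< 2` having only real zeros and `ψ ≢ c·e^{βw}` in the Laguerre–Pólya class" (equivalently: `Φ/φ` has a real-rooted Fourier transform for the universal factor `φ(u) = ψ(iu)` [cite: NewmanWu2020, Thm. 2]) is CLOSED by this barrier when `ψ` has a Gaussian factor (`ψ = e^{−αw²}ψ₂`, `α > 0`, `ψ₂` Laguerre–Pólya: then `H_{−α} = ψ₂(D)G` translated is real-rooted), CLOSED IN THE TREE (not in print) when `ψ` has a pair of opposite zeros `±b` (then `F_b = (1 − D²/b²)⁻¹H_0`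 is real-rooted, refuted for every `b > 0` by `Summit.RiemannHypothesis.RiemannHypothesis.Theorems.UniversalFactorLaplaceLoophole_refuted`), and otherwise — `ψ = c·e^{βw}∏(1 − w/b_k)e^{w/b_k}` with no two `b_k` opposite — IMPLIES the linear-factor route `∃ a ≠ 0, HasOnlyRealZeros (linearFactorH a)` (factor `ψ = (1 − w/b)ψ₁`, `ψ₁` Laguerre–Pólya, so `(1 − D/b)⁻¹H_0 = ψ₁(D)G` is real-rooted by Hermite–Poulain/Pólya) — proved or refuted nowhere as a whole, expected false, and closed on its wide window `0 < |a| < π/8` (`Φ(ia) ≠ 0`) by a one-signed tail plus growth (proofs-companion audit, last section), so that `|a| ≥ π/8` (and `a = ±a₀`) is what remains; `NewmanConjecture`, the summit-side Laplace refutation and a refutation of the linear ray would together close the whole class. What transfers to the linear ray and what does not is listed in the last section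

[cite: RodgersTaoFMP2020, Theorem 1.1] -/
def NewmanConjecture : Prop :=
  ¬ DeBruijnRoute

/-- `NewmanConjecture` is the tree's `sInf`-free Rodgers–Tao fact `Literature.NumberTheory.LFunctions.rodgers_tao`
(`∀ t < 0, ¬ HasOnlyRealZeros (H_t)`), by pure logic. [cite: RodgersTaoFMP2020, Theorem 1.1] -/
theorem NewmanConjecture_iff_rodgers_tao : NewmanConjecture ↔ Literature.NumberTheory.LFunctions.rodgers_tao := by
  constructor
  · intro h t ht hreal
    exact h ⟨t, ht, hreal⟩
  · rintro h ⟨t, ht, hreal⟩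
    exact h t ht hreal

/-- The catalogued barrier from the vendored fact. [cite: RodgersTaoFMP2020, Theorem 1.1] -/
theorem NewmanConjecture_of_rodgers_tao (h : Literature.NumberTheory.LFunctions.rodgers_tao) : NewmanConjecture :=
  NewmanConjecture_iff_rodgers_tao.2 h

/-- `Λ ≥ 0` in the `sInf` form (`Literature.deBruijnNewmanConst = sInf {t | H_t has only real zeros}`), from the
barrier and the nonemptiness fact `Literature.NumberTheory.LFunctions.hasOnlyRealZeros_deBruijnH_one_half` (de Bruijn: `H_{1/2}` has
only real zeros). [cite: RodgersTaoFMP2020, Theorem 1.1] -/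
theorem deBruijnNewmanConst_nonneg_of_NewmanConjecture (h : NewmanConjecture)
    (hne : Literature.NumberTheory.LFunctions.hasOnlyRealZeros_deBruijnH_one_half) : 0 ≤ Literature.NumberTheory.LFunctions.deBruijnNewmanConst := by
  refine le_csInf ⟨1 / 2, hne⟩ fun t ht ↦ ?_
  by_contra hlt
  exact h ⟨t, lt_of_not_ge hlt, ht⟩

/-! ## What `Λ ≥ 0` does not close: Laguerre–Pólya deformations whose symbol has a real zero

Barrier audit 2026-08-16 (NARROWING of the claimed technique class, not of the theorem). Pólya's
*universal factors* are the functions `φ` such that `∫ φ(u)F(u)e^{izu} du` has only real zeros whenever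
`∫ F(u)e^{izu} du` does; Pólya characterised them: `φ` is universal iff `φ(iz)` is an entire function of
the Laguerre–Pólya class `𝓛𝓟` [NewmanWu2020, Thm. 2 (Pólya 1927)]. Multiplying the kernel by `φ(u) = ψ(iu)`
is the operator `ψ(D)` on the transform (`D = d/dz`, `D e^{izu} = iu·e^{izu}`). The technique class
"universal factors / Laguerre–Pólya deformations" therefore consists of the routes
`Route(ψ)`: *`Φ/ψ(i·)` has a real-rooted cosine/Fourier transform `G`* (then `H_0 = ψ(D)G` is
real-rooted, i.e. RH), one for each non-trivial `ψ ∈ 𝓛𝓟`. Four cases, by the factors of `ψ`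
(a route through `ψ` implies the route through each `𝓛𝓟`-factor `ψ₀` of `ψ`, since
`ψ₀(D)⁻¹H_0 = (ψ/ψ₀)(D)G` and `(ψ/ψ₀)(D)` preserves `𝓛𝓟` — Hermite–Poulain–Pólya):
* `ψ` has a Gaussian factor `e^{−αw²}`, `α > 0` — de Bruijn's route (`G`-image `H_{−α}`): CLOSED by this
  barrier, `Λ ≥ 0` [RodgersTaoFMP2020, Thm. 1.1];
* `ψ` has two opposite real zeros `±b` (every real EVEN universal factor, de Bruijn's cone
  `e^{λu²}∏(1 + u²/a_k²)`): the route implies that `F_b := (1 − D²/b²)⁻¹H_0 = (b/2)∫ H_0(· − s)e^{−b|s|} ds`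
  is real-rooted — CLOSED IN THE TREE for every `b > 0`, NOT IN PRINT (Cardon's Question 7): the summit-side
  refutation `Summit.RiemannHypothesis.RiemannHypothesis.Theorems.UniversalFactorLaplaceLoophole_refuted`
  (route `Summits/RiemannHypothesis/RiemannHypothesis/Theses/UniversalFactor.lean`, 2026-08-16; wide
  `b < π/8` by the residue `F_b(x) ∼ b e^{−b|x|}∫₀^∞H_0 cosh(b·)`, the endpoint mechanism of
  [LagariasMontague2011, Thm. 2.1] one pole up; `π/8 ≤ b ≤ 32` by kernel-checked one-point Laguerre
  certificates, among them Lehmer's pair `γ ≈ 7005.06, 7005.10`; `b ≥ 32` uniformly, by a log-free energy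
  gap for the Lorentz-filtered Hardy function, L²-pigeonhole to a zero-free window of FIXED length, three
  zeta ordinates in it, and two-step Laguerre interlacing), together with
  `…Theses.UniversalFactor.MixedFactorReduction_holds`; strip-narrowing factors such as de Bruijn's
  `cosh(εu)` (`ψ = cos(εw)`) fall here, and independently die by picket-fence rigidity (the real zeros of
  `H_0 = Re F(· + iε)` would be level crossings of a phase with Poisson-smooth derivative, hence
  asymptotically equally spaced as in [Lagarias2005, Thm. 4.1], against Montgomery's small gaps under RH
  [Montgomery1973], RH being free here);
* `ψ(0) = 0`: the route factors through integration `D⁻¹`, CLOSED in print: `ξ^{(−1)} + c` has zeros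
  arbitrarily far from the line for every constant `c` [LagariasMontague2011, Thms. 2.1–2.2];
* otherwise `ψ = c·e^{βw}∏(1 − w/b_k)e^{w/b_k}` with no two `b_k` opposite (Pólya's HERMITIAN, non-even
  universal factors `φ(u) = ψ(iu)`, e.g. `1 − iu/b`): the route implies, for `b = b_1`, that the ONE-SIDED
  exponential smoothing `G_b = (1 − D/b)⁻¹H_0`, `G_b(z) = b∫₀^∞ e^{−bs}H_0(z + s) ds` (`b > 0`; mirror image
  for `b < 0`, `linearFactorH_neg`) is real-rooted — the *linear-factor route*
  `∃ a ≠ 0, HasOnlyRealZeros (linearFactorH a)` below. It is WEAKER than the refuted Laplace statement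
  (`G_a = (1 + D/a)F_a`, so `F_a` real-rooted gives `G_a` real-rooted, not conversely) and is proved or
  refuted NOWHERE (print searched 2026-08-16: arXiv "de Bruijn Newman constant" (13 hits), [NewmanWu2020]
  §2.2–2.4 and the general-kernel section, [BrandenChasse2014] §1 and §6, [Lagarias2005],
  [LagariasMontague2011]; tree: `ledger negatives`, route UniversalFactor works the even cone only).
So the residual, uncovered family is ONE-PARAMETRIC, and `NewmanConjecture`, the summit-side Laplace
refutation and a refutation of the linear ray would together close the whole class.

Attack surface of the linear ray (informal, this audit): EXPECTED FALSE. What transfers from the even ray: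
(i) bounded `a` — on the local model `x² − δ²/4` of an isolated close pair of real zeros of `H_0`,
`(1 − D/a)⁻¹(x² − δ²/4) = (x + 1/a)² + 1/a² − δ²/4`, so the pair leaves the real axis as soon as
`|a|δ < 2` (`2√2` for the Laplace factor): Lehmer's pair (`δ ≈ 0.075` in `x = 2γ`, `1/24` of the local
mean spacing) should kill `|a| ≲ 26`, closer pairs higher up more [CsordasSmithVarga1994], and one-point
Laguerre certificates `G_a G_a'' − G_a'² > 0` are certifiable exactly as on the even ray; (ii) `|a| < π/8` —
only the LEFT tail is governed by the residue (`G_a(x) ∼ πaΦ(ia)e^{ax}` as `x → −∞`), the right tail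
oscillates; one governed tail nevertheless SUFFICES — the wide window is CLOSED, see the correction below
(proofs-companion audit). What does NOT transfer:
(iii) the `a`-uniform kill — the one-sided kernel `a e^{−as}𝟙_{s>0}` has a jump, its multiplier
`a/(a − iu)` decays like `1/u` only, the derivative energy of the filtered Hardy function is `≍ T log T`
(not `≍ T`), pigeonhole yields zero-free windows of `G_a` of length `≍ (log T)^{−1/2}` only, and ONE
Laguerre step allows one zeta ordinate per window, so a contradiction would need gaps between consecutive
zeta zeros `≫ (log T)^{−1/2}` at height `T` — the order of the GUE-predicted maximal gaps, not available;
equally, infinitely many sufficiently isolated SMALL normalised gaps would do (GUE-expected, not known even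
under RH, cf. [RodgersTaoFMP2020, §1] on the Lehmer-pair strategy).

Correction and additions (proofs-companion audit of `NewmanConjectureProofs.lean`, 2026-08-16; informal):
* *the wide window of the linear ray is CLOSED: for `0 < |a| < π/8` with `Φ(ia) ≠ 0`, `linearFactorH a` has a
  non-real zero* (supersedes the "no contradiction" clause of (ii)). Take `a > 0` (mirror symmetry). LEFT TAIL:
  `G_a(x) = a e^{ax}∫_x^∞ e^{−aw}H_0(w) dw` and `∫_ℝ e^{−aw}H_0(w) dw = 2∫₀^∞cosh(aw)H_0(w) dw = πΦ(ia)`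
  (cosine inversion of `H_0 = ∫₀^∞Φ(u)cos(wu) du`, continued to `|Im u| < π/8`; absolutely convergent since
  `H_0(w) ≪ |w|²e^{−π|w|/8}`), so `G_a(x) = aπΦ(ia)e^{ax}(1 + O(|x|²e^{(π/8−a)x}))` as `x → −∞`: no zeros of
  `G_a` on `(−∞, −X₀]` and `log|G_a(−x)| = −ax + O(1)`. GROWTH: `Re G_a(iy) = ∫₀^∞Φ(u)cosh(yu)(1 + u²/a²)⁻¹ du
  ≥ c_U e^{(U−1)y}` for every `U ≥ 1` (`Φ > 0`), so `G_a` — real entire of order `≤ 1`, as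
  `|G_a(x+iy)| ≤ ∫₀^∞Φ(u)(1 + u/a)cosh(yu) du` — is of infinite type along `iℝ`. CONTRADICTION: if all zeros
  `g_k` of `G_a` were real, all but finitely many would be positive; in the Hadamard form
  `G_a = Cz^m e^{αz}∏(1 − z/g_k)e^{z/g_k}` (genus `≤ 1`, `α` real) each positive zero with `g_k ≤ x/3`
  contributes `log(1 + x/g_k) − x/g_k ≤ −x/(2g_k)` to `log|G_a(−x)|`, the other positive zeros contribute `≤ 0`
  and the finitely many negative ones `O(1 + x)`, so `−ax + O(1) = log|G_a(−x)| ≤ B(1 + x) + m log x −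
  (x/2)Σ_{0<g_k≤x/3} g_k⁻¹`, whence `Σ_k |g_k|⁻¹ < ∞`; then `G_a = Cz^m e^{α'z}∏(1 − z/g_k)` with a genus-0
  product of minimal type (`Σ log(1 + r/|g_k|) = ∫₀^∞ n(t) r dt/(t(t + r)) = o(r)` because `n(t) = o(t)` and
  `∫^∞ n(t)t⁻² dt < ∞`), i.e. `log|G_a(iy)| ≤ m log y + o(y)` — against GROWTH. So one governed tail plus
  real-rootedness is already contradictory; the even ray needed both tails only to avoid the Hadamard step.
  HADAMARD-FREE VARIANT (the tree's own toolkit, `Literature/Analysis/Complex/LaguerrePolya.lean`; this is the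
  form to formalise): the mechanism is that a real entire `f` of order `< 2` with only real zeros has a
  log-derivative of slope at least `1/dist²` to any zero — `(Im z)·Im(f'/f)(z) ≤ −(Im z)²/‖z − g‖²` for every
  zero `g` (`Literature.Analysis.Complex.im_mul_im_logDeriv_le`) — whereas the left tail of `G_a` is a PURE
  exponential up to an exponentially small error. Concretely: (1) `G_a' = a(G_a − H_0)` on `ℂ` (from
  `linearFactorH_eq_deBruijnHDiv_add_deriv` and the ODE `F_a − F_a''/a² = H_0`,
  `Literature.NumberTheory.LFunctions.deBruijnHDiv_laplace_sub_deriv_deriv`), so `G_a'/G_a = a − aH_0/G_a`;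
  (2) tail LIMIT only: `e^{−ax}G_a(x) → aπΦ(ia) ≠ 0` as `x → −∞` (dominated convergence, as the summit-side
  `tendsto_exp_mul_deBruijnHDiv_laplace` does for `F_a`), hence `‖G_a(−X)‖ ≥ c e^{−aX}` for `X ≥ X₀`, and by
  vertical monotonicity (`Literature.Analysis.Complex.monotoneOn_norm_sq_vertical`) also `‖G_a(−X + i)‖ ≥ c e^{−aX}`;
  (3) `‖H_0(−X + i)‖ ≤ C_b e^{−bX}` for any `a < b < π/8` (the Lagarias–Montague strip bound
  `Literature.NumberTheory.LFunctions.LagariasMontague2011_lem_3_3_i_holds`, as in the summit-side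
  `exists_norm_deBruijnH_zero_real_le_exp`); (4) `G_a` has a zero `g` (else
  `Literature.Analysis.Complex.norm_vertical_eq_of_forall_ne_zero` gives `‖G_a(iy)‖ = ‖G_a(0)‖`, against
  `Re G_a(iy) = F_a(iy) ≥ κe^{y}`, the summit-side `UniversalFactor.exists_exp_le_re_deBruijnHDiv_laplace_I`;
  `F_a'(iy) ∈ iℝ`). Then at `z = −X + i`: `−1/((X + g)² + 1) ≥ Im(G_a'/G_a)(z) = −a·Im(H_0/G_a)(z) ≥
  −(aC_b/c)e^{−(b−a)X}` for all `X ≥ X₀` — absurd as `X → ∞`. No zero counting, no factorisation; the only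
  analytic inputs beyond the tree are the Fubini representation `G_a(x) = a∫₀^∞e^{−as}H_0(x + s) ds` with its
  tail limit, a Literature copy of the three summit-side lemmas named, and `G_a` real of order `< 2` (from
  `F_a`, `F_a'`). A prover can land it as `¬ HasOnlyRealZeros (linearFactorH a)` under `0 < |a| < π/8`,
  `∫₀^∞ H_0 cosh(a·) ≠ 0` in the proofs companion `NewmanConjectureProofs.lean` (Literature imports only).
  `Φ(ia)` on `(0, π/8)`: `Φ(ia) > 0` for `a ≤ 0.3188` is KERNEL-CHECKED in the tree (theta cells,
  `Summit.RiemannHypothesis.RiemannHypothesis.Theses.UniversalFactor.PhiICert.re_tsum_pos_wide` with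
  `…UniversalFactor.coshIntegral_eq_deBruijnPhiC`, file `Theorems/LaplaceLoophole/Negative/LaplaceLoopholeWideWindow.lean`);
  numerically (double precision, `2·10⁴` terms; script `phi_iy.py` of this audit) `a ↦ Φ(ia)` increases from
  `Φ(0) = 0.44670` to `≈ 3.51` at `a ≈ 0.28`, vanishes ONCE, at `a₀ = 0.3194150268…` (the residue zero of the
  even ray), is negative on `(a₀, 0.388]` (minimum `≈ −15.5` near `a = 0.355`) and tends to `0` with all its
  derivatives as `a → π/8` [Edwards1974, §11.1] (below double precision on `(0.388, π/8)`, where the cusp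
  asymptotics `θ(i + ε) ≈ 2ε^{−1/2}e^{−π/(4ε)}` give a fixed sign). Net: the linear ray is OPEN exactly for
  `|a| ≥ π/8` (both tails of `G_a` then oscillate at the rate `e^{−π|x|/8}` of `H_0`) and at `a = ±a₀`.
* *the normalisation `linearFactorH` loses nothing.* A route may posit ANY real entire `G` of order `< 2` with
  `ψ(D)G = H_0`, not only the kernel-division transform. In the reduction above this yields `F = ψ₁(D)G` in
  `𝓛𝓟` with `(1 − D/b)F = H_0`, i.e. `F = G_b + Ce^{bz}` with `C` real (first-order equation); `C ≠ 0` is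
  impossible: for `b > 0`, `F(x) = Ce^{bx}(1 + o(1))` as `x → +∞` (`G_b → 0` on `ℝ`, Riemann–Lebesgue), so `F`
  has finitely many positive zeros, and the computation of the previous item at `+x` gives `Σ|g_k|⁻¹ < ∞` and
  `log|F(iy)| = o(y)`, against `|F(iy)| ≥ Re G_b(iy) − |C|`. Likewise in the Gaussian case `G` IS
  `c⁻¹H_{−α}(· − β)` (`e^{−αD²}` is injective on order `< 2`). Hence `∃ a ≠ 0, HasOnlyRealZeros (linearFactorH a)`
  is exactly the residual family, with nothing hidden in the choice of particular solution.
* *medium window, how it would be certified.* With `Q(x) = ∫₀^∞H_0(x + y)e^{−ay} dy = G_a(x)/a` (the one-sided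
  average already computed with certified numerics on the even ray, `UniversalFactor.osaWindowD/H`,
  `stub_lowWindowA`, the Lehmer point `x₀ = 14010.16`) one has `Q' = aQ − H_0`, and the one-point Laguerre
  expression is `QQ'' − Q'² = Q(aH_0 − H_0') − H_0²`; at a zero `γ` of `H_0` the certificate `G_a ∉ 𝓛𝓟` reads
  `Q(γ)H_0'(γ) < 0` — the exponentially weighted future of `H_0` after `γ` has the sign opposite to the lobe
  just after `γ`, which is what a close pair `γ, γ + δ` with `aδ ≪ 1` followed by an ordinary lobe produces
  (the local model (i)). So `π/8 ≤ |a| ≤ A` is certifiable exactly as `MediumKernelNoGo` was; the `a`-uniform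
  statement remains the open part (iii).
* *deformations of `Ξ` outside the `ψ(D)` class are not addressed by this entry at all* — e.g. Romik's Poisson
  flows `X_r^φ = Σ rⁿγ_nφ_n` attached to orthogonal-polynomial expansions of `Ξ` [Romik2019, §5]: in the Hermite
  basis `X_r^𝓗(t) = Ξ_{(r²−1)/4}(rt)` is the Pólya–de Bruijn flow at NEGATIVE time [Romik2019, Thm. 9], so by
  `Λ ≥ 0` no `X_r^𝓗`, `r < 1`, is hyperbolic; in the Meixner–Pollaczek basis `f_n` the flow is entire of
  exponential type [Romik2019, Thm. 15] but its operator does not preserve hyperbolicity [Romik2019, Prop. 18],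
  so no transfer "`X_r^𝓕` hyperbolic ⇒ RH" exists and it is not a route in the sense of this entry (Romik's
  open question, a discrete-time preservation for one `r₀ < 1` [Romik2019, §(open problems)], would make it
  one — uncovered by `Λ ≥ 0` and by the dichotomy above). Multiplier-sequence (Hadamard-diagonal) preservers
  `{γ_k}` (Pólya–Schur) are likewise a different operator family from `ψ(D)` and are not claimed here.
-/

/-- The **linear-factor deformation** `G_a = (1 − D/a)⁻¹ H_0` of `H_0 = Literature.NumberTheory.LFunctions.deBruijnH 0`,
as an absolutely convergent kernel integral:
`G_a(z) = ∫₀^∞ Φ(u)/(1 + u²/a²) · (cos(zu) − (u/a) sin(zu)) du = ½∫_ℝ Φ(u) e^{izu}/(1 − iu/a) du`,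
the Fourier transform of `Φ` divided by the linear universal factor `φ(u) = 1 − iu/a` (`φ(iz) = 1 + z/a`,
Laguerre–Pólya) [cite: NewmanWu2020, Thm. 2]. Since `(1 − D/a)(cos(zu) − (u/a)sin(zu)) = (1 + u²/a²)cos(zu)`,
formally `G_a − G_a'/a = H_0`; for `a > 0` equivalently `G_a(z) = a∫₀^∞ e^{−as} H_0(z + s) ds` (the bounded
solution). `G_a` is real on `ℝ`, entire of order `≤ 1`, not even: `G_a(−z) = G_{−a}(z)` (`linearFactorH_neg`).
At `a = 0` the integrand is junk (`u/0 = 0`, `u²/0 = 0` give `H_0`); the route below excludes `a = 0`.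

Relation to the summit-side route `UniversalFactor`: `linearFactorH a = (1 + D/a)F_a` where
`F_a = Literature.NumberTheory.LFunctions.deBruijnHDiv (fun u ↦ 1 + u²/a²)` is its Laplace-smoothed
transform (apply `1 + D/a` under the integral: `(1 + D/a)cos(zu) = cos(zu) − (u/a)sin(zu)`).

The **linear-factor route** is the statement `∃ a ≠ 0, HasOnlyRealZeros (linearFactorH a)` (kept
INLINE in the theorems below and deliberately not a named `Prop`: no source proves or refutes it, so it is
neither a Literature fact nor a barrier; a planner who wants it attacked files it as an item, and a
refutation `¬ ∃ a ≠ 0, …` — "Newman's conjecture for the linear universal factors" — would, together with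
`NewmanConjecture` and the summit-side `UniversalFactorLaplaceLoophole_refuted`, close the whole
Laguerre–Pólya deformation class). It would give RH: `G_a` real entire of order `≤ 1` with only real zeros
is in the Laguerre–Pólya class, which is closed under `G ↦ e^{cz}G` and differentiation (Laguerre, Pólya),
so `H_0 = G_a − G_a'/a = −a⁻¹e^{az}(e^{−az}G_a)'` has only real zeros, i.e. RH
(`Literature.NumberTheory.LFunctions.riemannHypothesis_iff_hasOnlyRealZeros_deBruijnH_zero`). It is
EXPECTED FALSE ("if RH is true it is only barely so") and is NOT decided by the refutation of the stronger
Laplace statement (`F_a` real-rooted ⇒ `G_a` real-rooted, not conversely); bounded ranges of `a` should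
fall to isolated close pairs of zeta zeros [cite: CsordasSmithVarga1994] and one-point Laguerre
certificates, the wide window `0 < |a| < π/8` (`Φ(ia) ≠ 0`) IS closed — its one-signed left tail
`G_a(x) ∼ πaΦ(ia)e^{ax}` (`x → −∞`) plus a growth argument (section docstring, proofs-companion audit) — and
the `a`-uniform statement for `|a| ≥ π/8` is the open part (section docstring). By
`exists_hasOnlyRealZeros_linearFactorH_iff_exists_pos` one may take `a > 0`.
Definition introduced by the barrier audit of 2026-08-16 (not in print under this name). -/
def linearFactorH (a : ℝ) (z : ℂ) : ℂ :=
  ∫ u in Set.Ioi (0 : ℝ),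
    ((Literature.NumberTheory.LFunctions.deBruijnPhi u / (1 + u ^ 2 / a ^ 2) : ℝ) : ℂ) *
      (Complex.cos (z * u) - ((u / a : ℝ) : ℂ) * Complex.sin (z * u))

/-- Mirror symmetry of the family: `G_a(−z) = G_{−a}(z)` (the kernel `Φ(u)/(1 + u²/a²)` is even in `a`,
`cos` is even and `sin` is odd). [folklore] -/
theorem linearFactorH_neg (a : ℝ) (z : ℂ) : linearFactorH a (-z) = linearFactorH (-a) z := by
  simp [linearFactorH, div_neg, Complex.cos_neg, Complex.sin_neg, neg_mul, sub_eq_add_neg]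

/-- **`G_a = (1 + D/a)F_a`**: the one-sided smoothing is the first Laguerre step applied to the
Laplace-smoothed transform `F_a = Literature.NumberTheory.LFunctions.deBruijnHDiv (1 + u²/a²)` of route
`UniversalFactor` — `linearFactorH a z = F_a(z) + a⁻¹F_a'(z)`, by differentiation under the integral sign
(`IsDivAdmissible.deriv_deBruijnHDiv`: `F_a' = −∫₀^∞ u Φ(u)/(1 + u²/a²) sin(zu) du`) and linearity of the
Bochner integral (both pieces converge absolutely). Hence `F_a` real-rooted would give `G_a` real-rooted
(Laguerre), not conversely; at `a = 0` both sides are `H_0(z)` (junk-consistent). [folklore] -/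
theorem linearFactorH_eq_deBruijnHDiv_add_deriv (a : ℝ) (z : ℂ) :
    linearFactorH a z =
      Literature.NumberTheory.LFunctions.deBruijnHDiv (fun u : ℝ => 1 + u ^ 2 / a ^ 2) z +
        (a : ℂ)⁻¹ * deriv (Literature.NumberTheory.LFunctions.deBruijnHDiv fun u : ℝ => 1 + u ^ 2 / a ^ 2) z := by
  have hm : Literature.NumberTheory.LFunctions.IsDivAdmissible (fun u : ℝ => 1 + u ^ 2 / a ^ 2) :=
    Literature.NumberTheory.LFunctions.isDivAdmissible_laplace a
  have hA : MeasureTheory.IntegrableOn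
      (fun u : ℝ ↦ ((Literature.NumberTheory.LFunctions.deBruijnPhi u / (1 + u ^ 2 / a ^ 2) : ℝ) : ℂ) *
        Complex.cos (z * u)) (Set.Ioi 0) := by
    refine (hm.integrableOn_divCosIntegrand 0 z).congr_fun (fun u _ ↦ ?_) measurableSet_Ioi
    simp [Literature.NumberTheory.LFunctions.divCosIntegrand, Literature.NumberTheory.LFunctions.divWeight]
  have hB : MeasureTheory.IntegrableOn
      (fun u : ℝ ↦ ((u * (Literature.NumberTheory.LFunctions.deBruijnPhi u / (1 + u ^ 2 / a ^ 2)) : ℝ) : ℂ) *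
        Complex.sin (z * u)) (Set.Ioi 0) := by
    refine (hm.integrableOn_divSinIntegrand 1 z).congr_fun (fun u _ ↦ ?_) measurableSet_Ioi
    simp [Literature.NumberTheory.LFunctions.divSinIntegrand, Literature.NumberTheory.LFunctions.divWeight]
  rw [hm.deriv_deBruijnHDiv]
  simp only [Literature.NumberTheory.LFunctions.deBruijnHDiv, Literature.NumberTheory.LFunctions.divSinMoment,
    Literature.NumberTheory.LFunctions.divSinIntegrand, Literature.NumberTheory.LFunctions.divWeight, pow_one,
    mul_neg, ← sub_eq_add_neg]
  rw [← MeasureTheory.integral_const_mul, ← MeasureTheory.integral_sub hA (hB.const_mul _)]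
  refine MeasureTheory.setIntegral_congr_fun measurableSet_Ioi fun u _ ↦ ?_
  push_cast
  ring

/-- `G_{−a}` has only real zeros iff `G_a` does (their zero sets are negatives of each other, by
`linearFactorH_neg`). [folklore] -/
theorem hasOnlyRealZeros_linearFactorH_neg_iff (a : ℝ) :
    Literature.NumberTheory.LFunctions.HasOnlyRealZeros (linearFactorH (-a)) ↔
      Literature.NumberTheory.LFunctions.HasOnlyRealZeros (linearFactorH a) := by
  constructor
  · intro h z hz
    have h' : linearFactorH (-a) (-z) = 0 := by rw [← linearFactorH_neg, neg_neg]; exact hz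
    simpa using h (-z) h'
  · intro h z hz
    have h' : linearFactorH a (-z) = 0 := by rw [linearFactorH_neg]; exact hz
    simpa using h (-z) h'

/-- The linear-factor route (inline): without loss of generality `a > 0` (mirror symmetry
`hasOnlyRealZeros_linearFactorH_neg_iff`). [folklore] -/
theorem exists_hasOnlyRealZeros_linearFactorH_iff_exists_pos :
    (∃ a : ℝ, a ≠ 0 ∧ Literature.NumberTheory.LFunctions.HasOnlyRealZeros (linearFactorH a)) ↔
      ∃ a : ℝ, 0 < a ∧ Literature.NumberTheory.LFunctions.HasOnlyRealZeros (linearFactorH a) := by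
  constructor
  · rintro ⟨a, ha, h⟩
    rcases lt_or_gt_of_ne ha with hlt | hgt
    · exact ⟨-a, neg_pos.2 hlt, (hasOnlyRealZeros_linearFactorH_neg_iff a).2 h⟩
    · exact ⟨a, hgt, h⟩
  · rintro ⟨a, ha, h⟩
    exact ⟨a, ha.ne', h⟩

end Literature.Barriers.RiemannHypothesis
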